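import Literature.MathematicalPhysics.QuantumLattice.HubbardSectorPropagatorGram
import Literature.MathematicalPhysics.QuantumLattice.TorusLabelDistance
import Literature.Probability.LatticeModels.TorusFourierDecayProduct
import HarnessLib

/-!
# The sectorised propagators of the Hubbard torus as character sums on the space-time dual torus

Topic `MathematicalPhysics/QuantumLattice`; the dictionary between the Hubbard host (`SectorisedKernelNorm.lean`:
space-time points `SpaceTimeIdx L M = Fin (2M) × (ℤ/Lℤ)²`, frequency–momenta `FreqMomentum L M = Fin (2M) × (ℤ/Lℤ)²`,
plane waves `hubbardPlaneWave β c k x = e^{-i s_c k·x}`; `HubbardSectorPropagatorGram.lean`: the sectorised propagators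
`C' = Sᵀ C S` of a normal covariance in closed form) and the discrete Fourier analysis of
`Probability/LatticeModels/TorusFourier*.lean` (characters `torusChar` of `(ℤ/nℤ)^d`, decay from differences of the
symbol, `TorusFourierAnisotropicDecay.lean`).  Benfatto–Giuliani–Mastropietro 2006, §2.1 and footnote ¹: at finite
`(β, L)` the propagators are finite Fourier sums over the `2M` Matsubara frequencies and the `L²` torus momenta; here
this is made literal, so that the finite-volume Lemma 2.2 (decay and `L¹` bounds of the single-scale sector
propagators, (2.52)/(2.81)) becomes a statement about product-torus character sums:

* `val_natCast_matsubaraIdx`, `bijective_matsubaraToTorus` — the Matsubara indices `Fin (2M)` ARE the time dual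
  torus `(ℤ/2Mℤ)¹` (`i ↦ (i mod 2M)`), and `sum_freqMomentum_eq_sum_prodTorus` reindexes momentum sums accordingly;
* **`conj_hubbardPlaneWave_mul_conj_hubbardPlaneWave`** — the phase of a `ψ⁺_x ψ⁻_y` contraction is a product-torus
  character up to a unimodular, momentum-INDEPENDENT factor:
  `conj(e^{-ik·x}) conj(e^{+ik·y}) = u(x₀,y₀) · χ_{i}(x₀ - y₀) · χ_{k⃗}(x⃗ - y⃗)`, `u = e^{iπ(1-2M)(x₀-y₀)/(2M)}`
  (the half-integer offset of the fermionic frequencies `π(2n+1)/β`);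
* **`norm_sum_conj_hubbardPlaneWave_mul_eq`** — hence for every symbol `Φ`,
  `‖Σ_k conj(e^{-ik·x}) conj(e^{ik·y}) Φ(k)‖ = ‖Σ_p χ_{p₁}(x₀-y₀) χ_{p₂}(x⃗-y⃗) • Φ(p)‖` over the product torus;
* **`norm_pullback_normalCovariance_le`** — the entries of the sectorised propagators of a normal covariance with
  symbol `p` and multipliers `F` are bounded by such character sums with symbol `(βL²)⁻² F_ω F_{ω'} p(·,σ)`, in the
  orientation `(x,y)` or `(y,x)` according to the charges (zero between equal charges or different spins);
* `sum_spaceTime_eq_sum_prodTorus` — summing a function of `(x₀-y₀, x⃗-y⃗)` over `y` is summing over the product torus;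
* `finCyclicDist_eq_abs_valMinAbs`, `torusSiteDist_le_abs_add_abs` — the label pseudo-distances of
  `TorusLabelDistance.lean` in the centred coordinates of the decay bounds:
  `finCyclicDist (2M) x₀ y₀ = |valMinAbs (x₀ - y₀)|`, `torusSiteDist x⃗ y⃗ ≤ |z̃₁| + |z̃₂|` (`z = x⃗ - y⃗`).

Everything is proved; no definitions, no named facts. [folklore]

## Sources

G. Benfatto, A. Giuliani, V. Mastropietro, Ann. Henri Poincaré 7 (2006) 809–898, §2.1 (2.2)–(2.5), Lemma 2.2 and
footnote ¹ (`BenfattoGiulianiMastropietro2006`); M. Salmhofer, *Renormalization* (1999), §4.2.4 (4.55)–(4.63)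
(`Salmhofer1999`).
-/

noncomputable section

namespace Literature.MathematicalPhysics.QuantumLattice

open Finset Complex Literature.Probability.LatticeModels
open scoped Real ComplexConjugate

variable {L M : ℕ}

/-! ### The Matsubara indices as the time dual torus -/

/-- `val (i mod 2M) = i` for a Matsubara index `i < 2M`. [folklore] -/
theorem val_natCast_matsubaraIdx [NeZero M] (i : MatsubaraIdx M) : (((i : ℕ) : ZMod (2 * M))).val = (i : ℕ) := by
  rw [ZMod.val_natCast, Nat.mod_eq_of_lt i.isLt]

/-- **The Matsubara indices are the time dual torus**: `i ↦ (i mod 2M)` is a bijection `Fin (2M) → (ℤ/2Mℤ)¹`. [folklore] -/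
theorem bijective_matsubaraToTorus [NeZero M] :
    Function.Bijective fun i : MatsubaraIdx M => (fun _ : Fin 1 => ((i : ℕ) : ZMod (2 * M)) : TorusSite 1 (2 * M)) := by
  have hinj : Function.Injective fun i : MatsubaraIdx M => (fun _ : Fin 1 => ((i : ℕ) : ZMod (2 * M)) : TorusSite 1 (2 * M)) := by
    intro i j h
    have h0 := congr_fun h 0
    have hv := congr_arg ZMod.val h0
    simp only [val_natCast_matsubaraIdx] at hv
    exact Fin.ext hv
  refine (Fintype.bijective_iff_injective_and_card _).2 ⟨hinj, ?_⟩
  rw [Fintype.card_fin, Fintype.card_pi, Fin.prod_const, ZMod.card, pow_one]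

/-- **Reindexing momentum sums over the product torus**: for `G` on `(ℤ/2Mℤ)¹ × (ℤ/Lℤ)²`,
`Σ_{(i,k⃗)} G((i mod 2M), k⃗) = Σ_p G(p)`. [folklore] -/
theorem sum_freqMomentum_eq_sum_prodTorus [NeZero L] [NeZero M] {E : Type*} [AddCommMonoid E]
    (G : TorusSite 1 (2 * M) × TorusSite 2 L → E) :
    ∑ k : FreqMomentum L M, G ((fun _ : Fin 1 => ((k.1 : ℕ) : ZMod (2 * M))), k.2) = ∑ p : TorusSite 1 (2 * M) × TorusSite 2 L, G p := by
  refine Fintype.sum_bijective (fun k : FreqMomentum L M => ((fun _ : Fin 1 => ((k.1 : ℕ) : ZMod (2 * M))), k.2))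
    ⟨fun k k' h => ?_, fun p => ?_⟩ _ _ fun k => rfl
  · have h' : ((fun _ : Fin 1 => ((k.1 : ℕ) : ZMod (2 * M))), k.2) = ((fun _ : Fin 1 => ((k'.1 : ℕ) : ZMod (2 * M))), k'.2) := h
    obtain ⟨h1, h2⟩ := Prod.mk.inj h'
    exact Prod.ext (bijective_matsubaraToTorus.1 h1) h2
  · obtain ⟨i, hi⟩ := bijective_matsubaraToTorus.2 p.1
    exact ⟨(i, p.2), Prod.ext hi rfl⟩

/-! ### The contraction phase is a product-torus character -/

/-- The spatial phase: `e^{i Σⱼ p_{k⃗,j}(xⱼ - yⱼ)} = χ_{k⃗}(x⃗ - y⃗)` (`p_{k⃗} = 2πk̃/L`). [folklore] -/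
theorem exp_latticeMomentum_phase_eq_torusChar [NeZero L] (k x y : TorusSite 2 L) :
    Complex.exp (((∑ j, latticeMomentum L k j * (((x j).val : ℝ) - ((y j).val : ℝ)) : ℝ) : ℂ) * I) =
      torusChar k (x - y) := by
  rw [torusChar, Complex.ofReal_sum, Finset.sum_mul, Complex.exp_sum]
  refine Finset.prod_congr rfl fun j _ => ?_
  have hcast : k j * (x - y) j = ((((k j).val : ℤ) * (((x j).val : ℤ) - ((y j).val : ℤ)) : ℤ) : ZMod L) := by
    push_cast
    rw [ZMod.natCast_zmod_val, ZMod.natCast_zmod_val, ZMod.natCast_zmod_val, Pi.sub_apply]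
  rw [hcast, ZMod.stdAddChar_coe, latticeMomentum]
  congr 1
  push_cast
  ring

/-- The temporal phase: `e^{i ω_i (x₀ - y₀)} = χ_{(i mod 2M)}(x₀ - y₀) · e^{iπ(1-2M)(x₀-y₀)/(2M)}` (`β ≠ 0`): the
fermionic frequency `π(2(i-M)+1)/β` at the times `jβ/(2M)` is the character `e^{2πi·ij/(2M)}` times a phase that does
not depend on `i`. [cite: Salmhofer1999, §4.2.4 (4.55)–(4.63)] -/
theorem exp_matsubara_phase_eq [NeZero M] {β : ℝ} (hβ : β ≠ 0) (i : MatsubaraIdx M) (x₀ y₀ : ImagTimeIdx M) :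
    Complex.exp (((matsubaraFreq β M i * (imagTime β M x₀ - imagTime β M y₀) : ℝ) : ℂ) * I) =
      torusChar (fun _ : Fin 1 => ((i : ℕ) : ZMod (2 * M)))
          (fun _ : Fin 1 => ((x₀ : ℕ) : ZMod (2 * M)) - ((y₀ : ℕ) : ZMod (2 * M))) *
        Complex.exp (((π * (1 - 2 * M) * (((x₀ : ℕ) : ℝ) - ((y₀ : ℕ) : ℝ)) / (2 * M) : ℝ) : ℂ) * I) := by
  have hM : (M : ℂ) ≠ 0 := by exact_mod_cast NeZero.ne M
  have hβ' : (β : ℂ) ≠ 0 := by exact_mod_cast hβ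
  rw [torusChar, Fin.prod_univ_one]
  have hcast : ((i : ℕ) : ZMod (2 * M)) * (((x₀ : ℕ) : ZMod (2 * M)) - ((y₀ : ℕ) : ZMod (2 * M))) =
      ((((i : ℕ) : ℤ) * (((x₀ : ℕ) : ℤ) - ((y₀ : ℕ) : ℤ)) : ℤ) : ZMod (2 * M)) := by push_cast; ring
  rw [hcast, ZMod.stdAddChar_coe, ← Complex.exp_add]
  congr 1
  simp only [matsubaraFreq, matsubaraInt, imagTime]
  push_cast
  field_simp
  ring

/-- **The phase of a `ψ⁺_x ψ⁻_y` contraction is a product-torus character** up to a unimodular factor independent of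
the momentum: `conj(e^{-ik·x}) · conj(e^{+ik·y}) = u(x₀,y₀) χ_{(i mod 2M)}(x₀-y₀) χ_{k⃗}(x⃗-y⃗)`,
`u = e^{iπ(1-2M)(x₀-y₀)/(2M)}` (`β ≠ 0`). [cite: BenfattoGiulianiMastropietro2006, §2.1 (2.2)–(2.5)] -/
theorem conj_hubbardPlaneWave_mul_conj_hubbardPlaneWave [NeZero L] [NeZero M] {β : ℝ} (hβ : β ≠ 0)
    (k : FreqMomentum L M) (x y : SpaceTimeIdx L M) :
    conj (hubbardPlaneWave L M β 0 k x) * conj (hubbardPlaneWave L M β 1 k y) =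
      Complex.exp (((π * (1 - 2 * M) * (((x.1 : ℕ) : ℝ) - ((y.1 : ℕ) : ℝ)) / (2 * M) : ℝ) : ℂ) * I) *
        (torusChar (fun _ : Fin 1 => ((k.1 : ℕ) : ZMod (2 * M)))
            (fun _ : Fin 1 => ((x.1 : ℕ) : ZMod (2 * M)) - ((y.1 : ℕ) : ZMod (2 * M))) *
          torusChar k.2 (x.2 - y.2)) := by
  have hconj : ∀ (r : ℝ), conj (Complex.exp (-((r : ℝ) : ℂ) * I)) = Complex.exp (((r : ℝ) : ℂ) * I) := fun r => by
    rw [← Complex.exp_conj, map_mul, map_neg, Complex.conj_ofReal, Complex.conj_I]; ring_nf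
  simp only [hubbardPlaneWave, chargeSign, if_true, show (1 : Fin 2) ≠ 0 by decide, if_false, one_mul,
    neg_one_mul, hconj]
  rw [← Complex.exp_add]
  -- split the phase into its temporal and spatial parts
  have hsplit : ((spaceTimePhase L M β k x : ℝ) : ℂ) * I + ((-spaceTimePhase L M β k y : ℝ) : ℂ) * I =
      ((matsubaraFreq β M k.1 * (imagTime β M x.1 - imagTime β M y.1) : ℝ) : ℂ) * I +
        ((∑ j, latticeMomentum L k.2 j * (((x.2 j).val : ℝ) - ((y.2 j).val : ℝ)) : ℝ) : ℂ) * I := by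
    rw [← add_mul, ← add_mul, ← Complex.ofReal_add, ← Complex.ofReal_add]
    congr 2
    simp only [spaceTimePhase]
    have : ∀ j, latticeMomentum L k.2 j * (((x.2 j).val : ℝ) - ((y.2 j).val : ℝ)) =
        latticeMomentum L k.2 j * ((x.2 j).val : ℝ) - latticeMomentum L k.2 j * ((y.2 j).val : ℝ) := fun j => by ring
    simp only [this, Finset.sum_sub_distrib]
    ring
  rw [hsplit, Complex.exp_add, exp_matsubara_phase_eq hβ, exp_latticeMomentum_phase_eq_torusChar]
  ring

/-- **Contraction sums are product-torus character sums**: for every symbol `Φ` and all space-time points `x, y`,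
`‖Σ_k conj(e^{-ik·x}) conj(e^{ik·y}) Φ(k)‖ = ‖Σ_p χ_{p₁}(x₀-y₀) χ_{p₂}(x⃗-y⃗) • Φ̃(p)‖` with `Φ̃` the symbol reindexed by
the time dual torus (`β ≠ 0`). [cite: BenfattoGiulianiMastropietro2006, §2.1 and footnote 1] -/
theorem norm_sum_conj_hubbardPlaneWave_mul_eq [NeZero L] [NeZero M] {β : ℝ} (hβ : β ≠ 0)
    (Φ : FreqMomentum L M → ℂ) (x y : SpaceTimeIdx L M) :
    ‖∑ k : FreqMomentum L M, conj (hubbardPlaneWave L M β 0 k x) * conj (hubbardPlaneWave L M β 1 k y) * Φ k‖ =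
      ‖∑ p : TorusSite 1 (2 * M) × TorusSite 2 L,
        (torusChar p.1 (fun _ : Fin 1 => ((x.1 : ℕ) : ZMod (2 * M)) - ((y.1 : ℕ) : ZMod (2 * M))) * torusChar p.2 (x.2 - y.2)) •
          Φ (⟨(p.1 0).val, ZMod.val_lt (p.1 0)⟩, p.2)‖ := by
  set u : ℂ := Complex.exp (((π * (1 - 2 * M) * (((x.1 : ℕ) : ℝ) - ((y.1 : ℕ) : ℝ)) / (2 * M) : ℝ) : ℂ) * I) with hu
  have hu1 : ‖u‖ = 1 := Complex.norm_exp_ofReal_mul_I _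
  -- pull out the unimodular factor and reindex
  have hsum : ∑ k : FreqMomentum L M, conj (hubbardPlaneWave L M β 0 k x) * conj (hubbardPlaneWave L M β 1 k y) * Φ k =
      u * ∑ p : TorusSite 1 (2 * M) × TorusSite 2 L,
        (torusChar p.1 (fun _ : Fin 1 => ((x.1 : ℕ) : ZMod (2 * M)) - ((y.1 : ℕ) : ZMod (2 * M))) * torusChar p.2 (x.2 - y.2)) •
          Φ (⟨(p.1 0).val, ZMod.val_lt (p.1 0)⟩, p.2) := by
    rw [Finset.mul_sum, ← sum_freqMomentum_eq_sum_prodTorus]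
    refine Finset.sum_congr rfl fun k _ => ?_
    rw [conj_hubbardPlaneWave_mul_conj_hubbardPlaneWave hβ, smul_eq_mul]
    have hk : (⟨(((k.1 : ℕ) : ZMod (2 * M))).val, ZMod.val_lt _⟩ : MatsubaraIdx M) = k.1 :=
      Fin.ext (val_natCast_matsubaraIdx k.1)
    rw [hk]
    ring
  rw [hsum, norm_mul, hu1, one_mul]

/-! ### The sectorised propagators of a normal covariance -/

section Pullback

variable [NeZero L] [NeZero M] {N : ℕ}

/-- **The sectorised propagators are bounded by product-torus character sums**: for a normal covariance with symbol
`p`, multipliers `F`, and auxiliary labels `Y = (x,((ω,σ),c))`, `Y' = (y,((ω',σ'),c'))`, the entry `C'(Y,Y')` has norm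
at most `‖Σ_p χ_{p₁}(x₀-y₀)χ_{p₂}(x⃗-y⃗) • G(p)‖ + ‖Σ_p χ_{p₁}(y₀-x₀)χ_{p₂}(y⃗-x⃗) • G(p)‖` with the symbol
`G = (βL²)⁻² F_ω F_{ω'} p(·,σ)` (the first term is the `(c,c') = (+,-)` orientation, the second the `(-,+)` one; at most
one is present). [cite: BenfattoGiulianiMastropietro2006, §2.7 (2.66)–(2.67)] -/
theorem norm_pullback_normalCovariance_le {β : ℝ} (hβ : β ≠ 0) (F : Fin N → FreqMomentum L M → ℂ)
    (p : FreqMomentum L M × Fin 2 → ℂ) (Y Y' : SpaceTimeIdx L M × SectorLeg N) :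
    ‖((sectorSubMatrix L M β F).transpose * normalCovariance L M p * sectorSubMatrix L M β F) Y Y'‖ ≤
      ‖∑ q : TorusSite 1 (2 * M) × TorusSite 2 L,
          (torusChar q.1 (fun _ : Fin 1 => ((Y.1.1 : ℕ) : ZMod (2 * M)) - ((Y'.1.1 : ℕ) : ZMod (2 * M))) *
              torusChar q.2 (Y.1.2 - Y'.1.2)) •
            ((((1 / (β * (L : ℝ) ^ 2) : ℝ) : ℂ) ^ 2 *
              (F Y.2.1.1 (⟨(q.1 0).val, ZMod.val_lt (q.1 0)⟩, q.2) *
                F Y'.2.1.1 (⟨(q.1 0).val, ZMod.val_lt (q.1 0)⟩, q.2) *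
                  p ((⟨(q.1 0).val, ZMod.val_lt (q.1 0)⟩, q.2), Y.2.1.2))))‖ +
      ‖∑ q : TorusSite 1 (2 * M) × TorusSite 2 L,
          (torusChar q.1 (fun _ : Fin 1 => ((Y'.1.1 : ℕ) : ZMod (2 * M)) - ((Y.1.1 : ℕ) : ZMod (2 * M))) *
              torusChar q.2 (Y'.1.2 - Y.1.2)) •
            ((((1 / (β * (L : ℝ) ^ 2) : ℝ) : ℂ) ^ 2 *
              (F Y.2.1.1 (⟨(q.1 0).val, ZMod.val_lt (q.1 0)⟩, q.2) *
                F Y'.2.1.1 (⟨(q.1 0).val, ZMod.val_lt (q.1 0)⟩, q.2) *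
                  p ((⟨(q.1 0).val, ZMod.val_lt (q.1 0)⟩, q.2), Y.2.1.2))))‖ := by
  set G : FreqMomentum L M → ℂ := fun k =>
    (((1 / (β * (L : ℝ) ^ 2) : ℝ) : ℂ) ^ 2 * (F Y.2.1.1 k * F Y'.2.1.1 k * p (k, Y.2.1.2))) with hG
  have hA := norm_sum_conj_hubbardPlaneWave_mul_eq hβ G Y.1 Y'.1
  have hB := norm_sum_conj_hubbardPlaneWave_mul_eq hβ G Y'.1 Y.1
  simp only [hG] at hA hB
  rw [← hA, ← hB]
  rw [sectorSub_pullback_normalCovariance_apply]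
  by_cases hσ : Y.2.1.2 = Y'.2.1.2
  · rw [if_pos hσ]
    by_cases h01 : Y.2.2 = 0 ∧ Y'.2.2 = 1
    · -- orientation `(+,-)`
      refine le_trans (le_of_eq ?_) (le_add_of_nonneg_right (norm_nonneg _))
      congr 1
      refine Finset.sum_congr rfl fun k _ => ?_
      rw [if_pos h01, h01.1, h01.2]
      ring
    · by_cases h10 : Y.2.2 = 1 ∧ Y'.2.2 = 0
      · -- orientation `(-,+)`
        refine le_trans (le_of_eq ?_) (le_add_of_nonneg_left (norm_nonneg _))
        rw [← norm_neg]
        congr 1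
        rw [← Finset.sum_neg_distrib]
        refine Finset.sum_congr rfl fun k _ => ?_
        rw [if_neg h01, if_pos h10, h10.1, h10.2]
        ring
      · refine le_trans (le_of_eq ?_) (add_nonneg (norm_nonneg _) (norm_nonneg _))
        rw [norm_eq_zero]
        exact Finset.sum_eq_zero fun k _ => by rw [if_neg h01, if_neg h10, mul_zero, zero_mul]
  · rw [if_neg hσ, norm_zero]
    positivity

end Pullback

/-! ### Sums over the second point and the label distances in centred coordinates -/

/-- **Summing over the second point is summing over the product torus**: for any `h`,
`Σ_{y ∈ SpaceTimeIdx} h(x₀ - y₀ mod 2M, x⃗ - y⃗) = Σ_{q} h(q)`. [folklore] -/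
theorem sum_spaceTime_eq_sum_prodTorus [NeZero L] [NeZero M] {E : Type*} [AddCommMonoid E]
    (h : TorusSite 1 (2 * M) × TorusSite 2 L → E) (x : SpaceTimeIdx L M) :
    ∑ y : SpaceTimeIdx L M, h ((fun _ : Fin 1 => ((x.1 : ℕ) : ZMod (2 * M)) - ((y.1 : ℕ) : ZMod (2 * M))), x.2 - y.2) =
      ∑ q : TorusSite 1 (2 * M) × TorusSite 2 L, h q := by
  -- `y ↦ (x₀ - y₀, x⃗ - y⃗)` is a bijection
  refine Fintype.sum_bijective (fun y : SpaceTimeIdx L M =>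
      ((fun _ : Fin 1 => ((x.1 : ℕ) : ZMod (2 * M)) - ((y.1 : ℕ) : ZMod (2 * M))), x.2 - y.2)) ?_ _ _ fun _ => rfl
  refine (Fintype.bijective_iff_injective_and_card _).2 ⟨fun y y' hyy => ?_, ?_⟩
  · have h1 := congr_fun (congr_arg Prod.fst hyy) 0
    have h2 := congr_arg Prod.snd hyy
    simp only [sub_right_inj] at h1 h2
    refine Prod.ext ?_ h2
    have hv := congr_arg ZMod.val h1
    rwa [val_natCast_matsubaraIdx, val_natCast_matsubaraIdx, ← Fin.ext_iff] at hv
  · simp only [Fintype.card_prod, Fintype.card_fin, Fintype.card_pi, Fin.prod_const, ZMod.card, pow_one]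

/-- **The cyclic distance of the time slices in centred coordinates**:
`finCyclicDist (2M) x₀ y₀ = |valMinAbs ((x₀ mod 2M) - (y₀ mod 2M))|`. [folklore] -/
theorem finCyclicDist_eq_abs_valMinAbs {n : ℕ} [NeZero n] (i j : Fin n) :
    finCyclicDist n i j = |(((((i : ℕ) : ZMod n) - ((j : ℕ) : ZMod n)).valMinAbs : ℤ) : ℝ)| := by
  rw [finCyclicDist, cyclicDist, ← ZMod.valMinAbs_natAbs_eq_min, Nat.cast_natAbs, Int.cast_abs]

/-- **The torus distance in centred coordinates** (two dimensions): `torusSiteDist x⃗ y⃗ ≤ |z̃₁| + |z̃₂|`, `z = x⃗ - y⃗`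
(the periodic `ℓ^∞` distance is the larger of the two, hence at most their sum). [folklore] -/
theorem torusSiteDist_le_abs_add_abs [NeZero L] (x y : TorusSite 2 L) :
    torusSiteDist x y ≤ |((((x - y) 0).valMinAbs : ℤ) : ℝ)| + |((((x - y) 1).valMinAbs : ℤ) : ℝ)| := by
  rw [torusSiteDist, torusDist, torusNorm]
  have hsup : (univ.sup fun i : Fin 2 => min ((x - y) i).val (L - ((x - y) i).val)) ≤
      ((x - y) 0).valMinAbs.natAbs + ((x - y) 1).valMinAbs.natAbs := by
    refine Finset.sup_le fun i _ => ?_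
    rw [← ZMod.valMinAbs_natAbs_eq_min]
    fin_cases i
    · exact Nat.le_add_right _ _
    · exact Nat.le_add_left _ _
  have h := (Nat.cast_le (α := ℝ)).2 hsup
  rw [Nat.cast_add, Nat.cast_natAbs, Nat.cast_natAbs, Int.cast_abs, Int.cast_abs] at h
  exact h

/-- **The space-time weight in centred coordinates**: for `cₓ ≥ 0`,
`spaceTimeDist (2M) cₜ cₓ x y ≤ cₜ |valMinAbs(x₀ - y₀)| + cₓ (|z̃₁| + |z̃₂|)`. [folklore] -/
theorem spaceTimeDist_le_centred [NeZero L] [NeZero M] {ct cx : ℝ} (hcx : 0 ≤ cx) (x y : SpaceTimeIdx L M) :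
    spaceTimeDist (2 * M) ct cx x y ≤
      ct * |(((((x.1 : ℕ) : ZMod (2 * M)) - ((y.1 : ℕ) : ZMod (2 * M))).valMinAbs : ℤ) : ℝ)| +
        cx * (|((((x.2 - y.2) 0).valMinAbs : ℤ) : ℝ)| + |((((x.2 - y.2) 1).valMinAbs : ℤ) : ℝ)|) := by
  rw [spaceTimeDist, finCyclicDist_eq_abs_valMinAbs]
  exact add_le_add le_rfl (mul_le_mul_of_nonneg_left (torusSiteDist_le_abs_add_abs _ _) hcx)

end Literature.MathematicalPhysics.QuantumLattice
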